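import Summits.Ventures.Crystal3D.Theorems.StickyWulffConstantPolycrystalWulffBoundArrangementRefinement

/-!
# `PolycrystalWulffBound`, rung `rung_basalLamellar` — step 2f: the disjoint refinement WITH ITS
# SIGN VECTORS (generic real inner product space; line `PolyDensity`, crux `stmt-Ventures-19482`)

Route `StickyWulffConstant` of the venture `Summits/Ventures/Crystal3D`, second prover lane (poly-p2,
gen 3).  `…ArrangementRefinementFull` enumerates the nonempty good cells of the arrangement of `𝓗`
but hides their sign vectors behind an existential.  The slab accounting of the anisotropic
Minkowski-content bound needs them (adjacency = sign vectors differing across one plane), so this file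
re-runs that construction and EXPOSES `T : Fin k → Finset (E × ℝ)` (cells
`⋂_{q ∈ sgn T j} {⟪q.1,·⟫ < q.2}`, `sgn T = 𝓗.image (p ↦ if p ∈ T then p else −p)`), together with:
`T j ⊆ 𝓗`, injectivity, COMPLETENESS (every nonempty good sign vector is enumerated), goodness, the
separating constraint behind each normal `ν j j' = ±p.1`, and the conclusions of the full refinement
(nonempty, antisymmetric `ν`, bounded, unit normals, distinct planes, disjoint, common plane, inside the
polyhedral set, a.e. exhaustion, dichotomy).  Proof = that of `exists_disjoint_polytope_refinement_full`.
WHAT THIS IS NOT: new mathematics; nothing on the crux.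
-/

noncomputable section

namespace Summit.Ventures.Crystal3D.Theorems

open MeasureTheory Set
open scoped RealInnerProductSpace Classical

variable {E : Type*} [NormedAddCommGroup E] [InnerProductSpace ℝ E] [FiniteDimensional ℝ E]
  [MeasurableSpace E] [BorelSpace E]

/-- **Disjoint refinement with exposed sign vectors.**  See the module docstring. -/
theorem exists_signed_refinement (𝓗 : Finset (E × ℝ)) (h1 : ∀ p ∈ 𝓗, ‖p.1‖ = 1)
    (𝒢 : Finset (Finset (E × ℝ))) (h𝒢 : ∀ G ∈ 𝒢, G ⊆ 𝓗)
    (hb : ∀ G ∈ 𝒢, Bornology.IsBounded (⋂ p ∈ G, {x : E | ⟪p.1, x⟫ < p.2})) :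
    ∃ (k : ℕ) (T : Fin k → Finset (E × ℝ)) (ν : Fin k → Fin k → E),
      (∀ j, T j ⊆ 𝓗) ∧
      (∀ j j', j ≠ j' → T j ≠ T j') ∧
      (∀ T' : Finset (E × ℝ), T' ⊆ 𝓗 → (∃ G ∈ 𝒢, G ⊆ T') →
        (⋂ q ∈ 𝓗.image (fun p : E × ℝ => if p ∈ T' then p else (-p.1, -p.2)),
          {x : E | ⟪q.1, x⟫ < q.2}).Nonempty → ∃ j, T j = T') ∧
      (∀ j, ∃ G ∈ 𝒢, G ⊆ T j) ∧
      (∀ j j', j ≠ j' → ∃ p ∈ 𝓗, ((p ∈ T j ∧ p ∉ T j') ∨ (p ∈ T j' ∧ p ∉ T j)) ∧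
        (ν j j' = p.1 ∨ ν j j' = -p.1)) ∧
      (∀ j, (⋂ q ∈ 𝓗.image (fun p : E × ℝ => if p ∈ T j then p else (-p.1, -p.2)),
        {x : E | ⟪q.1, x⟫ < q.2}).Nonempty) ∧
      (∀ i j, ν j i = -ν i j) ∧
      (∀ j, Bornology.IsBounded (⋂ q ∈ 𝓗.image (fun p : E × ℝ => if p ∈ T j then p else (-p.1, -p.2)),
        {x : E | ⟪q.1, x⟫ < q.2})) ∧
      (∀ j, ∀ q ∈ 𝓗.image (fun p : E × ℝ => if p ∈ T j then p else (-p.1, -p.2)), ‖q.1‖ = 1) ∧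
      (∀ j, ∀ q ∈ 𝓗.image (fun p : E × ℝ => if p ∈ T j then p else (-p.1, -p.2)),
        ∀ q' ∈ 𝓗.image (fun p : E × ℝ => if p ∈ T j then p else (-p.1, -p.2)), q ≠ q' →
        {x : E | ⟪q.1, x⟫ = q.2} ≠ {x : E | ⟪q'.1, x⟫ = q'.2}) ∧
      (∀ j j', j ≠ j' → Disjoint
        (⋂ q ∈ 𝓗.image (fun p : E × ℝ => if p ∈ T j then p else (-p.1, -p.2)), {x : E | ⟪q.1, x⟫ < q.2})
        (⋂ q ∈ 𝓗.image (fun p : E × ℝ => if p ∈ T j' then p else (-p.1, -p.2)), {x : E | ⟪q.1, x⟫ < q.2})) ∧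
      (∀ j j', j ≠ j' → ‖ν j j'‖ = 1 ∧ ∃ b : ℝ,
        closure (⋂ q ∈ 𝓗.image (fun p : E × ℝ => if p ∈ T j then p else (-p.1, -p.2)), {x : E | ⟪q.1, x⟫ < q.2}) ∩
          closure (⋂ q ∈ 𝓗.image (fun p : E × ℝ => if p ∈ T j' then p else (-p.1, -p.2)), {x : E | ⟪q.1, x⟫ < q.2}) ⊆
            {x : E | ⟪ν j j', x⟫ = b}) ∧
      (∀ j, (⋂ q ∈ 𝓗.image (fun p : E × ℝ => if p ∈ T j then p else (-p.1, -p.2)), {x : E | ⟪q.1, x⟫ < q.2}) ⊆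
        ⋃ G ∈ 𝒢, ⋂ p ∈ G, {x : E | ⟪p.1, x⟫ < p.2}) ∧
      ((⋃ G ∈ 𝒢, ⋂ p ∈ G, {x : E | ⟪p.1, x⟫ < p.2}) =ᵐ[volume]
        ⋃ j, ⋂ q ∈ 𝓗.image (fun p : E × ℝ => if p ∈ T j then p else (-p.1, -p.2)), {x : E | ⟪q.1, x⟫ < q.2}) ∧
      (∀ j, ∀ G : Finset (E × ℝ), G ⊆ 𝓗 →
        (⋂ q ∈ 𝓗.image (fun p : E × ℝ => if p ∈ T j then p else (-p.1, -p.2)), {x : E | ⟪q.1, x⟫ < q.2}) ⊆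
          (⋂ p ∈ G, {x : E | ⟪p.1, x⟫ < p.2}) ∨
        Disjoint (⋂ q ∈ 𝓗.image (fun p : E × ℝ => if p ∈ T j then p else (-p.1, -p.2)), {x : E | ⟪q.1, x⟫ < q.2})
          (⋂ p ∈ G, {x : E | ⟪p.1, x⟫ < p.2})) := by
  -- the signed constraint Finset and the cell of a positive part `T`
  set sgn : Finset (E × ℝ) → Finset (E × ℝ) :=
    fun T => 𝓗.image (fun p : E × ℝ => if p ∈ T then p else (-p.1, -p.2)) with hsgn
  set cell : Finset (E × ℝ) → Set E := fun T => ⋂ q ∈ sgn T, {x : E | ⟪q.1, x⟫ < q.2} with hcell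
  -- the nonempty good cells
  set goodAll : Finset (Finset (E × ℝ)) := 𝓗.powerset.filter (fun T => ∃ G ∈ 𝒢, G ⊆ T)
    with hgoodAll
  set good : Finset (Finset (E × ℝ)) := goodAll.filter (fun T => (cell T).Nonempty) with hgood
  have hgood_sub : ∀ T ∈ good, T ⊆ 𝓗 := fun T hT =>
    Finset.mem_powerset.1 (Finset.mem_filter.1 (Finset.mem_filter.1 hT).1).1
  have hgood_G : ∀ T ∈ good, ∃ G ∈ 𝒢, G ⊆ T := fun T hT =>
    (Finset.mem_filter.1 (Finset.mem_filter.1 hT).1).2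
  have hgood_ne : ∀ T ∈ good, (cell T).Nonempty := fun T hT => (Finset.mem_filter.1 hT).2
  -- enumeration
  set k : ℕ := good.card with hk
  set e : {T // T ∈ good} ≃ Fin k := good.equivFin with he
  set Tof : Fin k → Finset (E × ℝ) := fun j => (e.symm j).1 with hTof
  have hTof_mem : ∀ j, Tof j ∈ good := fun j => (e.symm j).2
  have hTof_inj : ∀ j j', j ≠ j' → Tof j ≠ Tof j' := by
    intro j j' hjj' h
    apply hjj'
    have : e.symm j = e.symm j' := Subtype.ext h
    simpa using congrArg e this
  -- separating constraint for two distinct cells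
  have hsep : ∀ j j', j ≠ j' → ∃ p ∈ 𝓗, (p ∈ Tof j ∧ p ∉ Tof j') ∨ (p ∈ Tof j' ∧ p ∉ Tof j) :=
    fun j j' hjj' => exists_mem_not_mem_of_ne (hgood_sub _ (hTof_mem j)) (hgood_sub _ (hTof_mem j'))
      (hTof_inj j j' hjj')
  -- the normals
  set ν₀ : Fin k → Fin k → E := fun j j' =>
    if h : j ≠ j' then (Classical.choose (hsep j j' h)).1 else 0 with hν₀
  -- common plane for the raw choice
  have hplane₀ : ∀ j j', j ≠ j' → ‖ν₀ j j'‖ = 1 ∧ ∃ b : ℝ,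
      closure (cell (Tof j)) ∩ closure (cell (Tof j')) ⊆ {x : E | ⟪ν₀ j j', x⟫ = b} := by
    intro j j' hjj'
    have hspec := Classical.choose_spec (hsep j j' hjj')
    set p := Classical.choose (hsep j j' hjj') with hpdef
    have hνp : ν₀ j j' = p.1 := by
      show (if h : j ≠ j' then (Classical.choose (hsep j j' h)).1 else 0) = p.1
      rw [dif_pos hjj']
    refine ⟨by rw [hνp]; exact h1 p hspec.1, p.2, ?_⟩
    rw [hνp]
    rcases hspec.2 with ⟨hpT, hpT'⟩ | ⟨hpT', hpT⟩
    · exact closure_arrCell_inter_subset_plane 𝓗 (Tof j) (Tof j') hspec.1 hpT hpT'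
    · rw [Set.inter_comm]
      exact closure_arrCell_inter_subset_plane 𝓗 (Tof j') (Tof j) hspec.1 hpT' hpT
  -- antisymmetrised normals
  set ν : Fin k → Fin k → E := fun i j =>
    if i < j then ν₀ i j else if j < i then -ν₀ j i else 0 with hν
  refine ⟨k, Tof, ν, fun j => hgood_sub _ (hTof_mem j), hTof_inj, ?_, fun j => hgood_G _ (hTof_mem j),
    ?_, ?_, ?_, ?_, ?_, ?_, ?_, ?_, ?_, ?_, ?_⟩
  · -- completeness
    intro T' hT' hG' hne'
    have hTall : T' ∈ goodAll := Finset.mem_filter.2 ⟨Finset.mem_powerset.2 hT', hG'⟩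
    have hTgood : T' ∈ good := Finset.mem_filter.2 ⟨hTall, hne'⟩
    refine ⟨e ⟨T', hTgood⟩, ?_⟩
    rw [hTof]; simp
  · -- the separating constraint behind `ν`
    intro j j' hjj'
    have hspec := Classical.choose_spec (hsep j j' hjj')
    set p := Classical.choose (hsep j j' hjj') with hpdef
    have hν₀p : ν₀ j j' = p.1 := by
      show (if h : j ≠ j' then (Classical.choose (hsep j j' h)).1 else 0) = p.1
      rw [dif_pos hjj']
    rcases lt_or_gt_of_ne hjj' with hlt | hgt
    · refine ⟨p, hspec.1, hspec.2, Or.inl ?_⟩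
      rw [hν]; simp [hlt, hν₀p]
    · -- `ν j j' = -ν₀ j' j`, and `ν₀ j' j` comes from the separating constraint of `(j', j)`
      have hspec' := Classical.choose_spec (hsep j' j (ne_of_lt hgt))
      set p' := Classical.choose (hsep j' j (ne_of_lt hgt)) with hp'def
      have hν₀p' : ν₀ j' j = p'.1 := by
        show (if h : j' ≠ j then (Classical.choose (hsep j' j h)).1 else 0) = p'.1
        rw [dif_pos (ne_of_lt hgt)]
      refine ⟨p', hspec'.1, hspec'.2.symm, Or.inr ?_⟩
      rw [hν]; simp [hgt, lt_asymm hgt, hν₀p']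

  · -- nonempty
    intro j
    exact hgood_ne _ (hTof_mem j)
  · -- antisymmetric
    intro i j
    rcases lt_trichotomy i j with hlt | heq | hgt
    · rw [hν]; simp [hlt, lt_asymm hlt]
    · subst heq; rw [hν]; simp
    · rw [hν]; simp [hgt, lt_asymm hgt]
  · -- bounded
    intro j
    obtain ⟨G, hG, hGT⟩ := hgood_G _ (hTof_mem j)
    exact isBounded_arrCell_of_subset 𝓗 (Tof j) (h𝒢 G hG) hGT (hb G hG)
  · -- unit normals
    intro j q hq
    exact norm_fst_eq_one_of_mem_signed 𝓗 (Tof j) h1 hq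
  · -- distinct planes
    intro j q hq q' hq' hqq'
    exact setOf_inner_eq_ne_of_arrCell_nonempty 𝓗 (Tof j) h1 (hgood_ne _ (hTof_mem j)) hq hq' hqq'
  · -- disjoint
    intro j j' hjj'
    obtain ⟨p, hp, h⟩ := hsep j j' hjj'
    rcases h with ⟨hpT, hpT'⟩ | ⟨hpT', hpT⟩
    · exact disjoint_arrCell 𝓗 (Tof j) (Tof j') hp hpT hpT'
    · exact (disjoint_arrCell 𝓗 (Tof j') (Tof j) hp hpT' hpT).symm
  · -- common plane (antisymmetrised)
    intro j j' hjj'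
    rcases lt_or_gt_of_ne hjj' with hlt | hgt
    · have hv : ν j j' = ν₀ j j' := by rw [hν]; simp [hlt]
      rw [hv]
      exact hplane₀ j j' hjj'
    · have hv : ν j j' = -ν₀ j' j := by rw [hν]; simp [hgt, lt_asymm hgt]
      rw [hv]
      obtain ⟨hn, b, hb'⟩ := hplane₀ j' j (ne_of_lt hgt)
      refine ⟨by rw [norm_neg]; exact hn, -b, ?_⟩
      intro x hx
      have := hb' (by rw [Set.inter_comm]; exact hx)
      simp only [mem_setOf_eq] at this ⊢
      rw [inner_neg_left, this]
  · -- inside the polyhedral set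
    intro j
    obtain ⟨G, hG, hGT⟩ := hgood_G _ (hTof_mem j)
    exact (arrCell_subset_polytope 𝓗 (Tof j) (h𝒢 G hG) hGT).trans
      (subset_iUnion₂ (s := fun G (_ : G ∈ 𝒢) => ⋂ p ∈ G, {x : E | ⟪p.1, x⟫ < p.2}) G hG)
  · -- a.e. equality: the good cells exhaust the set, empty cells are irrelevant
    have hn : ∀ p ∈ 𝓗, p.1 ≠ 0 := fun p hp h0 => by
      have := h1 p hp; rw [h0, norm_zero] at this; exact zero_ne_one this
    have hae := iUnion_polytope_ae_eq_iUnion_arrCell 𝓗 hn 𝒢 h𝒢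
    refine hae.trans (ae_eq_set.2 ⟨?_, ?_⟩ : _)
    · -- goodAll-union \ enumerated union is EMPTY
      rw [Set.sdiff_eq_empty.2 ?_, measure_empty]
      intro x hx
      rw [mem_iUnion₂] at hx
      obtain ⟨T, hT, hxT⟩ := hx
      have hTgood : T ∈ good := Finset.mem_filter.2 ⟨hT, ⟨x, hxT⟩⟩
      refine mem_iUnion.2 ⟨e ⟨T, hTgood⟩, ?_⟩
      have : Tof (e ⟨T, hTgood⟩) = T := by
        rw [hTof]; simp
      show x ∈ cell (Tof (e ⟨T, hTgood⟩))
      rw [this]; exact hxT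
    · rw [Set.sdiff_eq_empty.2 ?_, measure_empty]
      intro x hx
      rw [mem_iUnion] at hx
      obtain ⟨j, hxj⟩ := hx
      exact mem_iUnion₂.2 ⟨Tof j, (Finset.mem_filter.1 (hTof_mem j)).1, hxj⟩
  · -- dichotomy against every sub-Finset of constraints
    intro j G hG
    by_cases hGT : G ⊆ Tof j
    · exact Or.inl (arrCell_subset_polytope 𝓗 (Tof j) hG hGT)
    · exact Or.inr (disjoint_arrCell_polytope 𝓗 (Tof j) hG hGT)

end Summit.Ventures.Crystal3D.Theorems

end
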